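import Literature.AnabelianGeometry.AbsoluteAnabelian.AbsTopIII.ReconstructionCor110KummerImageInvariant
import HarnessLib

/-!
# [AbsTopIII] Cor. 1.10 (ii)(d): the Kummer image on an ABSTRACT profinite group of MLF type — chart independence

Mochizuki, *Topics in Absolute Anabelian Geometry III*, Cor. 1.10 (ii)(d) pp. 42–43 and Rmk. 1.9.8 p. 40 (manuscript
pagination, lit key `paper:url-5493eb38cbb7`): the Kummer image is constructed by a «functorial "group-theoretic"
algorithm» — «phrased in language that only depends on the topological group structure».  This file makes that
literal for the abc-iut cell's abstract inputs (abc-iut layer L4, row «Cor110ii-PRIME» follow-on, abc-iut-L4-d1):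
* `Cor110iiPrime.galCyclotomeH1Map_trans` — `H¹(β ∘ α; μ_Ẑ) = H¹(β; μ_Ẑ) ∘ H¹(α; μ_Ẑ)` on abc-iut-L4-t1's
  group-theoretic cyclotome (functoriality of the transport in isomorphisms);
* `Cor110iiPrime.natFamily` / `natKummerImage k ⊆ H¹(G_k, μ_Ẑ(G_k))` — THE natural family of Cor. 1.10 (i)(b)
  (a choice of witness of `AbsTopIII.cor_1_10_i_b_natural_holds`) and its Kummer images (`kummerImageOf`), which ARE
  the Kummer images of the `kˣ` and are respected by every `H¹(α; μ_Ẑ(α))`;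
* `Cor110iiPrime.natKummerImage_chart_independent` — for an ABSTRACT topological group `G` and ANY two «MLF charts»
  `ι₁ : G ≃ₜ* G_{k₁}`, `ι₂ : G ≃ₜ* G_{k₂}` (possibly different fields, possibly non-geometric), the pull-backs of the
  Kummer images agree: `H¹(ι₁) x ∈ K_{k₁} ↔ H¹(ι₂) x ∈ K_{k₂}` — so «the Kummer image of `G`» is a well-defined
  subgroup of `H¹(G, μ_Ẑ(G))` depending only on the topological group `G` (e.g. `G = E.gal` of a
  `FundamentalExtension`, through any `CurveModel.galIso`).
Definitions with bodies + theorems; no named fact, no `sorry`.  HONEST FRAMING: classical; nothing here bears on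
[IUTchIII] Cor. 3.12 or takes a side.
-/

noncomputable section

open CategoryTheory Function
open Field ValuativeRel

universe u

namespace Literature.AnabelianGeometry.AbsoluteAnabelian

open _root_.TopRep _root_.ContRepresentation _root_.ContinuousCohomology
open Literature.NumberTheory.GaloisRepresentations

namespace Cor110iiPrime

/-! ### Functoriality of `H¹(α; μ_Ẑ(α))` in `α` -/

section Trans

variable {G : Type u} [Group G] [TopologicalSpace G] [IsTopologicalGroup G] [CompactSpace G]
  {G' : Type u} [Group G'] [TopologicalSpace G'] [IsTopologicalGroup G'] [CompactSpace G']
  {G'' : Type u} [Group G''] [TopologicalSpace G''] [IsTopologicalGroup G''] [CompactSpace G'']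

/-- `μ_Ẑ(β ∘ α) = μ_Ẑ(β) ∘ μ_Ẑ(α)` on the additive carriers. [cite: MochizukiAbsTopIII2015, Cor 1.10 (i) p.42] -/
theorem congrL_trans (α : G ≃ₜ* G') (β : G' ≃ₜ* G'') (m : MuZhatMod G) :
    MuZhatMod.congrL (α.trans β) m = MuZhatMod.congrL β (MuZhatMod.congrL α m) := by
  apply (show Function.Injective (MuZhatMod.toMuZhat (G := G'')) from fun _ _ h => h)
  rw [MuZhatMod.toMuZhat_congrL, MuZhatMod.toMuZhat_congrL, MuZhatMod.toMuZhat_congrL]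
  refine Subtype.ext (funext fun n => ?_)
  rw [muZhat.map_apply_coe, muZhat.map_apply_coe, muZhat.map_apply_coe, toAdd_ofAdd, muQZ.map_trans]

/-- **`H¹(β ∘ α; μ_Ẑ) = H¹(β; μ_Ẑ) ∘ H¹(α; μ_Ẑ)`**: the transport of the cohomology of the group-theoretic cyclotome
along isomorphisms is functorial. [cite: MochizukiAbsTopIII2015, Cor 1.10 (i) p.42] -/
theorem galCyclotomeH1Map_trans (α : G ≃ₜ* G') (β : G' ≃ₜ* G'') (x : galCyclotomeH1 G) :
    galCyclotomeH1Map (α.trans β) x = galCyclotomeH1Map β (galCyclotomeH1Map α x) := by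
  obtain ⟨c, rfl⟩ := oneCocycleClass_surjective _ x
  rw [show galCyclotomeH1Map (α.trans β) (oneCocycleClass _ c) = _ from map_oneCocycleClass _ _ _ c,
    show galCyclotomeH1Map α (oneCocycleClass _ c) = _ from map_oneCocycleClass _ _ _ c,
    show galCyclotomeH1Map β (oneCocycleClass _ _) = _ from map_oneCocycleClass _ _ _ _]
  congr 1
  refine Subtype.ext (ContinuousMap.ext fun σ => ?_)
  rw [contOneCocycles.pullback_apply, contOneCocycles.pullback_apply, contOneCocycles.pullback_apply]
  change MuZhatMod.congrL (α.trans β) (c.1 ((α.trans β).symm σ)) =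
    MuZhatMod.congrL β (MuZhatMod.congrL α (c.1 (α.symm (β.symm σ))))
  rw [congrL_trans]
  rfl

/-- `H¹(α; μ_Ẑ(α))` only depends on the underlying map of `α`. [cite: MochizukiAbsTopIII2015, Cor 1.10 (i) p.42] -/
theorem galCyclotomeH1Map_congr {α α' : G ≃ₜ* G'} (h : ∀ g, α g = α' g) (x : galCyclotomeH1 G) :
    galCyclotomeH1Map α x = galCyclotomeH1Map α' x := by
  have : α = α' := ContinuousMulEquiv.ext h
  subst this
  rfl

end Trans

/-! ### THE natural family and its Kummer images -/

section Family

/-- A witness family of `AbsTopIII.Cor_1_10_i_b_natural` (abc-iut-L4-d3's `cor_1_10_i_b_natural_holds`): THE natural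
isomorphisms `j_k : H¹(G_k, μ_Ẑ(G_k)) ≃+ G_k^{ab}` of Cor. 1.10 (i)(b). [cite: MochizukiAbsTopIII2015, Cor 1.10 (i) p.42] -/
def natFamily : ∀ (k : Type) [Field k] [ValuativeRel k] [TopologicalSpace k] [IsNonarchimedeanLocalField k]
    [CharZero k], galCyclotomeH1 (absoluteGaloisGroup k) ≃+ Additive (absoluteGaloisGroupAbelianization k) :=
  Classical.choose AbsTopIII.cor_1_10_i_b_natural_holds

variable (k : Type) [Field k] [ValuativeRel k] [TopologicalSpace k] [IsNonarchimedeanLocalField k] [CharZero k]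

/-- **THE Kummer image `K_k ⊆ H¹(G_k, μ_Ẑ(G_k))`** = `j_k⁻¹(𝔄_k⁰)` for THE natural family (print's recipe of (ii)(d)).
[cite: MochizukiAbsTopIII2015, Cor 1.10 (ii) p.42] -/
def natKummerImage : AddSubgroup (galCyclotomeH1 (absoluteGaloisGroup k)) := kummerImageOf (natFamily k)

/-- `K_k` IS the image of the Kummer map `kˣ → H¹(G_k, μ_Ẑ(G_k))` (for some `G_k`-equivariant
`φ : μ_{ℚ/ℤ}(G_k) ≅ μ(k̄)`). [cite: MochizukiAbsTopIII2015, Cor 1.10 (ii) p.42] -/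
theorem natKummerImage_isKummerImage :
    ∃ (φ : muQZ (absoluteGaloisGroup k) ≃+ Additive (CommGroup.torsion (AlgebraicClosure k)ˣ))
      (hφ : ∀ (σ : absoluteGaloisGroup k) (x : muQZ (absoluteGaloisGroup k)),
        (((Additive.toMul (φ (σ • x)) : CommGroup.torsion (AlgebraicClosure k)ˣ) :
            (AlgebraicClosure k)ˣ) : AlgebraicClosure k) =
          σ • (((Additive.toMul (φ x) : CommGroup.torsion (AlgebraicClosure k)ˣ) :
            (AlgebraicClosure k)ˣ) : AlgebraicClosure k)),
      ∀ x, x ∈ natKummerImage k ↔ ∃ a : kˣ, kummerGalCyclotome hφ a = Multiplicative.ofAdd x := by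
  obtain ⟨φ, hφ, hj⟩ := (Classical.choose_spec AbsTopIII.cor_1_10_i_b_natural_holds).1 k
  exact ⟨φ, hφ, mem_kummerImageOf_iff hj⟩

variable {k}
variable {k₁ k₂ : Type} [Field k₁] [ValuativeRel k₁] [TopologicalSpace k₁]
  [IsNonarchimedeanLocalField k₁] [CharZero k₁] [Field k₂] [ValuativeRel k₂] [TopologicalSpace k₂]
  [IsNonarchimedeanLocalField k₂] [CharZero k₂]

/-- The natural Kummer images correspond under `H¹(α; μ_Ẑ(α))` for every `α : G_{k₁} ≃ₜ* G_{k₂}`.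
[cite: MochizukiAbsTopIII2015, Cor 1.10 (ii) p.42] -/
theorem galCyclotomeH1Map_mem_natKummerImage_iff (α : absoluteGaloisGroup k₁ ≃ₜ* absoluteGaloisGroup k₂)
    (x : galCyclotomeH1 (absoluteGaloisGroup k₁)) :
    galCyclotomeH1Map α x ∈ natKummerImage k₂ ↔ x ∈ natKummerImage k₁ :=
  galCyclotomeH1Map_mem_kummerImageOf_iff α
    ((Classical.choose_spec AbsTopIII.cor_1_10_i_b_natural_holds).2 k₁ k₂ α) x

end Family

/-! ### Chart independence on an abstract group -/

section Chart

variable {G : Type} [Group G] [TopologicalSpace G] [IsTopologicalGroup G] [CompactSpace G]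
  {k₁ k₂ : Type} [Field k₁] [ValuativeRel k₁] [TopologicalSpace k₁]
  [IsNonarchimedeanLocalField k₁] [CharZero k₁] [Field k₂] [ValuativeRel k₂] [TopologicalSpace k₂]
  [IsNonarchimedeanLocalField k₂] [CharZero k₂]

/-- **Chart independence — the Kummer image «only depends on the topological group structure» (Rmk. 1.9.8).**
For an ABSTRACT compact topological group `G` and ANY two identifications `ι₁ : G ≃ₜ* G_{k₁}`, `ι₂ : G ≃ₜ* G_{k₂}`
with absolute Galois groups of MLFs (different fields and non-geometric isomorphisms allowed), a class
`x ∈ H¹(G, μ_Ẑ(G))` lands in the Kummer image of `k₁ˣ` under `H¹(ι₁)` iff it lands in that of `k₂ˣ` under `H¹(ι₂)`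
(apply the invariance to `α := ι₁⁻¹ ≫ ι₂` and the functoriality `galCyclotomeH1Map_trans`).
[cite: MochizukiAbsTopIII2015, Cor 1.10 (ii) p.42] -/
theorem natKummerImage_chart_independent (ι₁ : G ≃ₜ* absoluteGaloisGroup k₁) (ι₂ : G ≃ₜ* absoluteGaloisGroup k₂)
    (x : galCyclotomeH1 G) :
    galCyclotomeH1Map ι₁ x ∈ natKummerImage k₁ ↔ galCyclotomeH1Map ι₂ x ∈ natKummerImage k₂ := by
  rw [← galCyclotomeH1Map_mem_natKummerImage_iff (ι₁.symm.trans ι₂) (galCyclotomeH1Map ι₁ x),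
    ← galCyclotomeH1Map_trans]
  rw [galCyclotomeH1Map_congr (α := ι₁.trans (ι₁.symm.trans ι₂)) (α' := ι₂)
    (fun g => by simp) x]

end Chart

end Cor110iiPrime

end Literature.AnabelianGeometry.AbsoluteAnabelian
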